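import Mathlib
import HarnessLib

/-!
# Thin-sector four-leg counting at an umklapp corner: the CLUSTER bound (definite normal form ⇒ `O(√l)` offsets ⇒ `O(1/l)` triples)

Topic `Literature/MathematicalPhysics/QuantumLattice`; namespace `ThinSectorCount`.  First file of the log-free ANISOTROPIC anchored
four-sector counting lemma on the square-lattice Fermi curve («E1-P2-THIN-COUNT», cell gate-hubbard-kl, plan g17 (R41); owner seat p4):
Mastropietro's Sector Lemma (*Non-Perturbative Renormalization*, (14.67), p. 223: with one sector held fixed the four-leg count is
`≤ c·γ^{(h₀−h)/2}`, NO `|h|`) = Benfatto–Giuliani–Mastropietro 2006 (2.89)/Lemma A3.1 — both for the umklapp-FREE convex case.  On the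
Hubbard curve at `μ ∈ klWindowC` four-leg umklapp is live, and the one new configuration is the `m = 3` UMKLAPP CORNER (HOME/prover-p4/
COUNTING-NOTE-2 §2, COUNTING-NOTE-3): anchor `k₁ ≡ 3p(θ*)` (mod `2πℤ²`), bundle `k₂ = k₄ = p(θ*)`, `k₃ = p(θ*+π) = −p(θ*)`.  Writing the
three summed legs as `p(θ*+α)`, `p(θ*+β)`, `p(θ*+π+s)` in thin boxes (tangential `l`, normal `≲ l²`), momentum conservation projected on
the bundle normal `n₀` reads `½κ₀(α² + β² + s²) = O(l) + cubic`, a DEFINITE form (the antipodal leg's curvature `−κ₀` enters with a `−`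
sign), and projected on the tangent `t₀` reads `α + β + s = τ + O(l)`.  This file is the curve-free algebra of that mechanism:

* §1 **`sumSq_le_of_quadratic_absorb`** — if `(κ₀/2)·S ≤ C·l + (A/6)·T + B·l·U` with `T ≤ ρ₀·S` (cubic Taylor remainder inside a chart
  of size `ρ₀`, `A·ρ₀ ≤ κ₀`), `U² ≤ 3S` (`U = |α|+|β|+|s|`), `0 < l ≤ 1`, then `S ≤ K·l` with the EXPLICIT `K = (27·B² + 6·κ₀·C)/κ₀²`;
* §2 **`card_int_triples_ball_slab_le`** — the lattice count behind «`O(√l)` offsets in three variables, one linear relation»: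
  `#{(i,j,k) ∈ [-R,R]³ ∩ ℤ³ : |i + j + k − T| ≤ D} ≤ (2R+1)²·(2D+1)` (for each `(i,j)`, at most `2D+1` values of `k`);
* §3 **`natAbs_le_ceil_sqrt_of_sq_le`**, **`card_le_of_cluster`**, **`cluster_card_bound_le`** — packaging: offsets with `α²+β²+s² ≤ K·l` on the lattice `l·ℤ`
  have indices in `[-R, R]`, `R = ⌈√(K/l)⌉₊`, hence with the tangential relation the number of admissible index triples is
  `≤ (2⌈√(K/l)⌉₊+1)²·(2D+1) ≤ (3√K + 3)²·(2D+1)/l` for `0 < l ≤ 1` — i.e. `O(N)` with `N ≍ 1/l` sectors, NO logarithm.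

Pure real analysis / combinatorics; everything is proved; no definitions, no named facts.
The geometric Taylor step (from boxes on the curve to the hypothesis of §1) and the assembly with the transversal and thin-Cooper
families are the next files.  Nothing asserts superconductivity.

## Sources

* V. Mastropietro, *Non-Perturbative Renormalization* (World Scientific, 2008), ch. 14, Sector Lemma (14.67), p. 223; p. 229 (isotropic
  `|h|`). [Mastropietro2008]
* G. Benfatto, A. Giuliani, V. Mastropietro, Ann. Henri Poincaré 7 (2006) 809–898, (2.89), App. A3 Lemma A3.1. [BenfattoGiulianiMastropietro2006]
-/

noncomputable section

namespace Literature.MathematicalPhysics.QuantumLattice.ThinSectorCount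

open Real Finset

/-! ## §1 The definite normal form absorbs the cubic remainder and the box tilt: `S ≤ K·l` -/

/-- **Absorption lemma** (the analytic heart of the corner cluster): let `κ₀ > 0`, `A, B, C ≥ 0`, `0 < l ≤ 1`, `0 ≤ S`, and suppose the
projected conservation law `(κ₀/2)·S ≤ C·l + (A/6)·T + B·l·U` holds with a cubic remainder `T ≤ ρ₀·S` inside a chart where
`A·ρ₀ ≤ κ₀`, and a tilt term with `0 ≤ U`, `U² ≤ 3·S` (`C` of either sign).  Then `S ≤ ((27·B² + 6·κ₀·C)/κ₀²)·l`.
(With `S = α²+β²+s²`, `T = |α|³+|β|³+|s|³`, `U = |α|+|β|+|s|`: all three offsets are `O(√l)`.) [cite: Mastropietro2008, ch. 14 (14.67)] -/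
theorem sumSq_le_of_quadratic_absorb {κ₀ A B C l S T U ρ₀ : ℝ} (hκ : 0 < κ₀) (hA : 0 ≤ A) (hB : 0 ≤ B)
    (hl : 0 < l) (hl1 : l ≤ 1) (hS : 0 ≤ S) (hT : T ≤ ρ₀ * S) (hρ : A * ρ₀ ≤ κ₀) (hU0 : 0 ≤ U) (hU : U ^ 2 ≤ 3 * S)
    (h : κ₀ / 2 * S ≤ C * l + A / 6 * T + B * l * U) : S ≤ (27 * B ^ 2 + 6 * κ₀ * C) / κ₀ ^ 2 * l := by
  -- absorb the cubic term: `(A/6)·T ≤ (κ₀/6)·S`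
  have hcub : A / 6 * T ≤ κ₀ / 6 * S := by
    have h1 : A * T ≤ A * (ρ₀ * S) := mul_le_mul_of_nonneg_left hT hA
    have h2 : A * (ρ₀ * S) ≤ κ₀ * S := by rw [← mul_assoc]; exact mul_le_mul_of_nonneg_right hρ hS
    linarith
  have hmain : κ₀ / 3 * S ≤ C * l + B * l * U := by linarith
  -- `X = √S`, `U ≤ √3·X`
  set X := Real.sqrt S with hX
  have hX0 : 0 ≤ X := Real.sqrt_nonneg _
  have hXS : X ^ 2 = S := Real.sq_sqrt hS
  have h3 : Real.sqrt 3 ^ 2 = 3 := Real.sq_sqrt (by norm_num)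
  have hs3 : 0 ≤ Real.sqrt 3 := Real.sqrt_nonneg _
  have hUX : U ≤ Real.sqrt 3 * X := by
    have : U = Real.sqrt (U ^ 2) := (Real.sqrt_sq hU0).symm
    rw [this, hX, ← Real.sqrt_mul (by norm_num : (0:ℝ) ≤ 3)]
    exact Real.sqrt_le_sqrt hU
  -- `(κ₀/3) X² ≤ C l + √3 B l X`
  have hq : κ₀ / 3 * X ^ 2 ≤ C * l + Real.sqrt 3 * B * l * X := by
    have := mul_le_mul_of_nonneg_left hUX (by positivity : 0 ≤ B * l)
    nlinarith [hmain, this, hXS]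
  -- AM–GM: `√3 B l X ≤ (κ₀/6) X² + 9 B² l²/(2κ₀)`  (from `(√κ₀ X/√6 − √6√3 B l/(2√κ₀))² ≥ 0`, i.e. `2ab ≤ a² + b²`)
  have hamgm : Real.sqrt 3 * B * l * X ≤ κ₀ / 6 * X ^ 2 + 9 * B ^ 2 * l ^ 2 / (2 * κ₀) := by
    have key : 0 ≤ κ₀ / 6 * X ^ 2 + 9 * B ^ 2 * l ^ 2 / (2 * κ₀) - Real.sqrt 3 * B * l * X := by
      have e : κ₀ / 6 * X ^ 2 + 9 * B ^ 2 * l ^ 2 / (2 * κ₀) - Real.sqrt 3 * B * l * X =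
          (κ₀ * X - 3 * Real.sqrt 3 * B * l) ^ 2 / (6 * κ₀) := by
        field_simp
        ring_nf
        rw [h3]
        ring
      rw [e]; positivity
    linarith
  have hl2 : l ^ 2 ≤ l := by nlinarith
  have h9 : 9 * B ^ 2 * l ^ 2 / (2 * κ₀) ≤ 9 * B ^ 2 / (2 * κ₀) * l := by
    rw [div_mul_eq_mul_div]
    exact div_le_div_of_nonneg_right (by nlinarith [sq_nonneg B]) (by positivity)
  -- `κ₀/6 · S ≤ (C + 9B²/(2κ₀)) l`, i.e. `S ≤ (6C/κ₀ + 27B²/κ₀²) l`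
  have hfin : κ₀ / 6 * S ≤ (C + 9 * B ^ 2 / (2 * κ₀)) * l := by nlinarith [hq, hamgm, hXS, h9]
  have hK : (27 * B ^ 2 + 6 * κ₀ * C) / κ₀ ^ 2 * l = 6 / κ₀ * ((C + 9 * B ^ 2 / (2 * κ₀)) * l) := by
    field_simp; ring
  rw [hK]
  have h6 : 0 < 6 / κ₀ := by positivity
  have := mul_le_mul_of_nonneg_left hfin h6.le
  have e1 : 6 / κ₀ * (κ₀ / 6 * S) = S := by field_simp
  linarith [e1]

/-! ## §2 Lattice points in a ball intersected with a slab: `(2R+1)²·(2D+1)` -/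

/-- **Integer triples with bounded entries and one linear relation**: for `R D : ℕ` and `T : ℤ`,
`#{(i,j,k) ∈ [−R,R]³ : |i + j + k − T| ≤ D} ≤ (2R+1)²·(2D+1)` — for each of the `(2R+1)²` pairs `(i,j)` the third index lies in an
interval of length `2D`. (The corner cluster: `R ≍ √(K/l)`, `D = O(1)` ⇒ `O(1/l) = O(N)` triples, no logarithm.)
[cite: BenfattoGiulianiMastropietro2006, App. A3 Lemma A3.1] -/
theorem card_int_triples_ball_slab_le (R D : ℕ) (T : ℤ) :
    (((Finset.Icc (-(R : ℤ)) R) ×ˢ ((Finset.Icc (-(R : ℤ)) R) ×ˢ (Finset.Icc (-(R : ℤ)) R))).filter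
      (fun ijk : ℤ × ℤ × ℤ => |ijk.1 + ijk.2.1 + ijk.2.2 - T| ≤ D)).card ≤ (2 * R + 1) ^ 2 * (2 * D + 1) := by
  classical
  -- fibre over `(i, j)`: `k ∈ [T − D − i − j, T + D − i − j] ∩ [−R, R]`, at most `2D + 1` values
  have hfib : ∀ ij : ℤ × ℤ, (((Finset.Icc (-(R : ℤ)) R)).filter (fun k : ℤ => |ij.1 + ij.2 + k - T| ≤ D)).card ≤ 2 * D + 1 := by
    intro ij
    calc (((Finset.Icc (-(R : ℤ)) R)).filter (fun k : ℤ => |ij.1 + ij.2 + k - T| ≤ D)).card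
        ≤ (Finset.Icc (T - D - ij.1 - ij.2) (T + D - ij.1 - ij.2)).card := by
          refine Finset.card_le_card fun k hk => ?_
          rw [Finset.mem_filter] at hk
          rw [Finset.mem_Icc]
          have := abs_le.1 hk.2
          constructor <;> linarith [this.1, this.2]
      _ = 2 * D + 1 := by
          rw [Int.card_Icc]
          have : T + ↑D - ij.1 - ij.2 + 1 - (T - ↑D - ij.1 - ij.2) = 2 * (D : ℤ) + 1 := by ring
          rw [this]; norm_cast
  -- reindex the triple filter as a sigma over `(i,j)`
  have hsplit : (((Finset.Icc (-(R : ℤ)) R) ×ˢ ((Finset.Icc (-(R : ℤ)) R) ×ˢ (Finset.Icc (-(R : ℤ)) R))).filter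
      (fun ijk : ℤ × ℤ × ℤ => |ijk.1 + ijk.2.1 + ijk.2.2 - T| ≤ D)).card ≤
      ∑ ij ∈ (Finset.Icc (-(R : ℤ)) R) ×ˢ (Finset.Icc (-(R : ℤ)) R),
        (((Finset.Icc (-(R : ℤ)) R)).filter (fun k : ℤ => |ij.1 + ij.2 + k - T| ≤ D)).card := by
    rw [← Finset.card_sigma]
    refine Finset.card_le_card_of_injOn (fun ijk => ⟨(ijk.1, ijk.2.1), ijk.2.2⟩) (fun ijk hijk => ?_) (fun a ha b hb hab => ?_)
    · rw [Finset.mem_coe, Finset.mem_filter, Finset.mem_product, Finset.mem_product] at hijk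
      rw [Finset.mem_coe, Finset.mem_sigma, Finset.mem_product, Finset.mem_filter]
      exact ⟨⟨hijk.1.1, hijk.1.2.1⟩, hijk.1.2.2, hijk.2⟩
    · simp only [Sigma.mk.injEq, Prod.mk.injEq, heq_eq_eq] at hab
      obtain ⟨⟨h1, h2⟩, h3⟩ := hab
      exact Prod.ext h1 (Prod.ext h2 h3)
  refine hsplit.trans ?_
  calc ∑ ij ∈ (Finset.Icc (-(R : ℤ)) R) ×ˢ (Finset.Icc (-(R : ℤ)) R),
        (((Finset.Icc (-(R : ℤ)) R)).filter (fun k : ℤ => |ij.1 + ij.2 + k - T| ≤ D)).card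
      ≤ ∑ _ij ∈ (Finset.Icc (-(R : ℤ)) R) ×ˢ (Finset.Icc (-(R : ℤ)) R), (2 * D + 1) := Finset.sum_le_sum fun ij _ => hfib ij
    _ = (2 * R + 1) ^ 2 * (2 * D + 1) := by
        rw [Finset.sum_const, Finset.card_product, Int.card_Icc, smul_eq_mul]
        have : ((R : ℤ) + 1 - -(R : ℤ)).toNat = 2 * R + 1 := by
          have : (R : ℤ) + 1 - -(R : ℤ) = ((2 * R + 1 : ℕ) : ℤ) := by push_cast; ring
          rw [this, Int.toNat_natCast]
        rw [this]; ring

/-! ## §3 Packaging: offsets of size `O(√l)` on the lattice `l·ℤ` -/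

/-- An offset `a = i·l` (`i : ℤ`, `0 < l`) with `a² ≤ K·l` has `|i| ≤ √(K/l)`, hence `i ∈ [−⌈√(K/l)⌉₊, ⌈√(K/l)⌉₊]`.
[cite: BenfattoGiulianiMastropietro2006, App. A3 Lemma A3.1] -/
theorem natAbs_le_ceil_sqrt_of_sq_le {l K : ℝ} (hl : 0 < l) {i : ℤ} (h : ((i : ℝ) * l) ^ 2 ≤ K * l) :
    -((⌈Real.sqrt (K / l)⌉₊ : ℕ) : ℤ) ≤ i ∧ i ≤ ((⌈Real.sqrt (K / l)⌉₊ : ℕ) : ℤ) := by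
  have hi2 : (i : ℝ) ^ 2 ≤ K / l := by
    rw [le_div_iff₀ hl]
    have : ((i : ℝ) * l) ^ 2 = (i : ℝ) ^ 2 * l * l := by ring
    nlinarith [this]
  have habs : |(i : ℝ)| ≤ Real.sqrt (K / l) := Real.abs_le_sqrt hi2
  have hceil : Real.sqrt (K / l) ≤ ((⌈Real.sqrt (K / l)⌉₊ : ℕ) : ℝ) := Nat.le_ceil _
  have h1 : |(i : ℝ)| ≤ ((⌈Real.sqrt (K / l)⌉₊ : ℕ) : ℝ) := habs.trans hceil
  have h2 : (|i| : ℤ) ≤ ((⌈Real.sqrt (K / l)⌉₊ : ℕ) : ℤ) := by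
    have : ((|i| : ℤ) : ℝ) ≤ ((⌈Real.sqrt (K / l)⌉₊ : ℕ) : ℝ) := by rw [Int.cast_abs]; exact h1
    exact_mod_cast this
  exact ⟨by linarith [neg_abs_le i], (le_abs_self i).trans h2⟩

/-- **The cluster count**: if every admissible index triple `(i,j,k)` (offsets `i·l, j·l, k·l`) has `(il)²+(jl)²+(kl)² ≤ K·l` and
`|i + j + k − T| ≤ D`, then the number of admissible triples in any finite set is `≤ (2⌈√(K/l)⌉₊ + 1)²·(2D + 1)`.
[cite: BenfattoGiulianiMastropietro2006, App. A3 Lemma A3.1] -/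
theorem card_le_of_cluster {l K : ℝ} (hl : 0 < l) (D : ℕ) (T : ℤ) (A : Finset (ℤ × ℤ × ℤ))
    (hA : ∀ ijk ∈ A, ((ijk.1 : ℝ) * l) ^ 2 + ((ijk.2.1 : ℝ) * l) ^ 2 + ((ijk.2.2 : ℝ) * l) ^ 2 ≤ K * l ∧
      |ijk.1 + ijk.2.1 + ijk.2.2 - T| ≤ D) :
    A.card ≤ (2 * ⌈Real.sqrt (K / l)⌉₊ + 1) ^ 2 * (2 * D + 1) := by
  classical
  set R : ℕ := ⌈Real.sqrt (K / l)⌉₊ with hR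
  refine le_trans (Finset.card_le_card (fun ijk hijk => ?_)) (card_int_triples_ball_slab_le R D T)
  obtain ⟨hsq, hlin⟩ := hA ijk hijk
  have h0 : ∀ x y z : ℝ, 0 ≤ x → 0 ≤ y → 0 ≤ z → x + y + z ≤ K * l → x ≤ K * l ∧ y ≤ K * l ∧ z ≤ K * l :=
    fun x y z hx hy hz h => ⟨by linarith, by linarith, by linarith⟩
  obtain ⟨h1, h2, h3⟩ := h0 _ _ _ (sq_nonneg _) (sq_nonneg _) (sq_nonneg _) hsq
  have b1 := natAbs_le_ceil_sqrt_of_sq_le hl h1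
  have b2 := natAbs_le_ceil_sqrt_of_sq_le hl h2
  have b3 := natAbs_le_ceil_sqrt_of_sq_le hl h3
  rw [Finset.mem_filter, Finset.mem_product, Finset.mem_product, Finset.mem_Icc, Finset.mem_Icc, Finset.mem_Icc]
  exact ⟨⟨⟨b1.1, b1.2⟩, ⟨b2.1, b2.2⟩, ⟨b3.1, b3.2⟩⟩, hlin⟩

/-- **The cluster count is `O(1/l)`**: `(2⌈√(K/l)⌉₊ + 1)²·(2D+1) ≤ (3·√K + 3)²·(2D+1)/l` for `0 < l ≤ 1` — with `N ≍ 1/l` sectors this is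
`O(N)`, no logarithm. [cite: Mastropietro2008, ch. 14 (14.67)] -/
theorem cluster_card_bound_le {l K : ℝ} (hl : 0 < l) (hl1 : l ≤ 1) (hK : 0 ≤ K) (D : ℕ) :
    (((2 * ⌈Real.sqrt (K / l)⌉₊ + 1) ^ 2 * (2 * D + 1) : ℕ) : ℝ) ≤ (3 * Real.sqrt K + 3) ^ 2 * (2 * D + 1) / l := by
  have hsl : 0 < Real.sqrt l := Real.sqrt_pos.2 hl
  have hsl1 : Real.sqrt l ≤ 1 := by rw [← Real.sqrt_one]; exact Real.sqrt_le_sqrt hl1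
  have hceil : ((⌈Real.sqrt (K / l)⌉₊ : ℕ) : ℝ) ≤ Real.sqrt (K / l) + 1 := (Nat.ceil_lt_add_one (Real.sqrt_nonneg _)).le
  have hKl : Real.sqrt (K / l) = Real.sqrt K / Real.sqrt l := Real.sqrt_div hK l
  -- `2⌈√(K/l)⌉ + 1 ≤ 2√K/√l + 3 ≤ (2√K + 3)/√l ≤ (3√K+3)/√l`
  have h1 : ((2 * ⌈Real.sqrt (K / l)⌉₊ + 1 : ℕ) : ℝ) ≤ (3 * Real.sqrt K + 3) / Real.sqrt l := by
    push_cast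
    rw [le_div_iff₀ hsl]
    have hK0 := Real.sqrt_nonneg K
    have e : Real.sqrt (K / l) * Real.sqrt l = Real.sqrt K := by rw [hKl, div_mul_cancel₀ _ hsl.ne']
    have : ((⌈Real.sqrt (K / l)⌉₊ : ℕ) : ℝ) * Real.sqrt l ≤ Real.sqrt K + Real.sqrt l := by
      have := mul_le_mul_of_nonneg_right hceil hsl.le
      rw [add_mul, e, one_mul] at this
      exact this
    nlinarith [this, hsl1, hK0]
  have h2 : (((2 * ⌈Real.sqrt (K / l)⌉₊ + 1) ^ 2 : ℕ) : ℝ) ≤ (3 * Real.sqrt K + 3) ^ 2 / l := by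
    push_cast
    have h0 : (0 : ℝ) ≤ ((2 * ⌈Real.sqrt (K / l)⌉₊ + 1 : ℕ) : ℝ) := by positivity
    have := pow_le_pow_left₀ h0 h1 2
    rw [div_pow, Real.sq_sqrt hl.le] at this
    push_cast at this
    exact this
  push_cast
  rw [show (3 * Real.sqrt K + 3) ^ 2 * (2 * (D : ℝ) + 1) / l = (3 * Real.sqrt K + 3) ^ 2 / l * (2 * (D : ℝ) + 1) by ring]
  push_cast at h2
  exact mul_le_mul_of_nonneg_right h2 (by positivity)

end Literature.MathematicalPhysics.QuantumLattice.ThinSectorCount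

end
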